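/-
COR-CM (cell pub-hodgecm2, stage 2 of the Hodge ladder) — junction B01 `PerLFace_of_PerL`, lane WEDGE-PROOF (seat b06), sequel:
the FULL displayed wedge leaf `Universe.HeckeWedge` (`CorCM/B01/FaceInputsSplit.lean` :61, p252201 — all degree-one classes,
the typed shape of Venkataramana 2001 Thm. 8 for `SU(2,1)`, `k = k' = 1`) from its HOLOMORPHIC case `Universe.HeckeWedge10`
(:177; PROVED on the model universe by the B01-H chain, `CorCM/B01/HeckeWedge10Holds.lean`) by Hodge symmetry and Hodge–Riemann.
Seat prover-pub-hodgecm2-b06-g21-0, 2026-08-21.  Theorems only; nothing cited as a record, nothing asserted; `Interfaces.lean` (C1),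
`Assembly/ModelChain*.lean` and `CorCM/B01/*` untouched.
-/
import Summits.HodgeConjecture.CorCM.B01.FaceInputsSplit
import Summits.HodgeConjecture.CorCM.Model.ModelFacts
import Summits.HodgeConjecture.CorCM.Model.CupRingFacts
import Literature.AlgebraicGeometry.Motives.HodgeStructureProofs
import HarnessLib

/-!
# `HeckeWedge` from `HeckeWedge10`: the Hecke-translate wedge for all degree-one classes

`Universe.HeckeWedge U` asks, for two NON-ZERO classes `a, a' ∈ H¹(P_Γ, ℂ)` of a Picard modular surface of `U`, for a
level `Γ'` and two morphisms `g h : P_{Γ'} → P_Γ` with `g^*a ∪ h^*a' ≠ 0`; `Universe.HeckeWedge10 U` asks the same only for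
classes of bidegree `(1,0)`.  For every universe whose Picard modular surfaces satisfy

* `F⁰H^k = H^k` (`Fact_hodge_F0`), `f^*` and `∪` respect the Hodge filtration (`Fact_pull_hodge`, `Fact_cup2_hodge`),
* the degree-one sign rules `a ∪ b = -(b ∪ a)` and `(a ∪ b) ∪ (c ∪ d) = -((a ∪ c) ∪ (b ∪ d))` (`Fact_cup_comm1`,
  `Fact_cup_interchange`, rows M19/M20),
* Hodge–Riemann for `(2,0)`-classes: `tr(η ∪ conj η) ≠ 0` for `0 ≠ η ∈ F²H²(P_Γ)`,

the holomorphic case implies the general one (`Universe.heckeWedge_of_heckeWedge10`).  PROOF.  Write `a = a₁ + conj b`,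
`a' = a'₁ + conj b'` with `a₁, b, a'₁, b' ∈ H^{1,0}` (`H¹_ℂ = F¹ ⊕ conj F¹`, `F¹ = H^{1,0}` as `F⁰ = H¹`).  The class
`g^*a ∪ h^*a'` splits into its components of type `(2,0)`, `(1,1)`, `(0,2)`, which are independent (Hodge decomposition of
`H²`, the tree's `HodgeStructure.iSupIndep_piece_holds`), so it is non-zero as soon as ONE component is.
(i) `a₁ ≠ 0`, `a'₁ ≠ 0`: choose `g, h` by `HeckeWedge10` for `(a₁, a'₁)`; the `(2,0)`-component is `g^*a₁ ∪ h^*a'₁ ≠ 0`.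
(ii) `a₁ = 0 = a'₁`: choose `g, h` for `(b, b')`; then `g^*a ∪ h^*a' = conj(g^*b ∪ h^*b') ≠ 0`.
(iii) `a₁ ≠ 0`, `a'₁ = 0` (so `b' ≠ 0`): choose `g, h` for `(a₁, b')`, so `η := g^*a₁ ∪ h^*b' ≠ 0` is a `(2,0)`-class and
`tr(η ∪ conj η) ≠ 0`; by the sign rules `η ∪ conj η = (g^*a₁ ∪ h^*b') ∪ (g^*conj a₁ ∪ h^*conj b')
= -((g^*a₁ ∪ h^*conj b') ∪ (g^*conj a₁ ∪ h^*b'))`, whence the `(1,1)`-component `g^*a₁ ∪ h^*conj b' = g^*a₁ ∪ h^*a'` of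
`g^*a ∪ h^*a'` is non-zero.  (iv) `a₁ = 0`, `a'₁ ≠ 0`: symmetric, with `η := g^*b ∪ h^*a'₁` and the `(1,1)`-component
`g^*a ∪ h^*a'₁`.

On the model universe `Model.universeOf hHD hI hU h₃` (hence on `Model.picardCMUniverse`) every listed fact and Hodge–Riemann
`(2,0)` are tree theorems (`Model.universeOf_fact_hodge_F0/_fact_pull_hodge/_fact_cup2_hodge/_cup_comm1/_cup_interchange`,
`Model.universeOf_hodgeRiemann_pms`), so `HeckeWedge10 → HeckeWedge` there unconditionally
(`Model.universeOf_heckeWedge_of_heckeWedge10`, `Model.picardCMUniverse_heckeWedge_of_heckeWedge10`); with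
`Model.heckeWedge10_holds` (`CorCM/B01/HeckeWedge10Holds.lean`) this makes the full leaf `HeckeWedge` a theorem of the model —
in print: T. N. Venkataramana, *Cohomology of compact locally symmetric spaces*, Compositio Math. 125 (2001) Thm. 8 p. 229 for
`G_ℝ = SU(2,1)`, `k = k' = 1`, all Hodge types (here: from the holomorphic case by linear algebra of the Hodge decomposition).
-/

noncomputable section

open scoped TensorProduct

namespace Summit.HodgeConjecture.CorCM

open Literature.AlgebraicGeometry.Motives (CMType HodgeStructure)
open Literature.AlgebraicGeometry.Motives.HodgeStructure (conj conj_conj complexConj mem_complexConj complexConj_top)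

namespace Universe

variable {U : Universe}

/-! ### Hodge decomposition bookkeeping in degrees one and two -/

/-- With `F⁰H¹ = H¹`: `H^{1,0} = F¹H¹`. [folklore] -/
theorem piece_one_zero_eq_F_one (hF0 : U.Fact_hodge_F0) (X : U.Var) :
    (U.hodge X 1).piece 1 0 = (U.hodge X 1).F 1 := by
  rw [HodgeStructure.piece_of_add_eq _ (by norm_num), hF0, complexConj_top, inf_top_eq]

/-- **`H¹_ℂ = H^{1,0} ⊕ conj H^{1,0}`**: every degree-one class is `a₁ + conj b` with `a₁, b` of type `(1,0)`
(`F¹` and `conj F¹` are complementary in weight one; `F⁰ = H¹`). [folklore] -/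
theorem exists_piece10_add_conj (hF0 : U.Fact_hodge_F0) (X : U.Var) (a : U.CohC X 1) :
    ∃ a₁ b : U.CohC X 1, a₁ ∈ (U.hodge X 1).piece 1 0 ∧ b ∈ (U.hodge X 1).piece 1 0 ∧ a = a₁ + conj b := by
  have htop : (U.hodge X 1).F 1 ⊔ complexConj ((U.hodge X 1).F 1) = ⊤ :=
    ((U.hodge X 1).isCompl_F_complexConj 1 1 (by norm_num)).sup_eq_top
  have ha : a ∈ (U.hodge X 1).F 1 ⊔ complexConj ((U.hodge X 1).F 1) := htop ▸ Submodule.mem_top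
  obtain ⟨y, hy, z, hz, hyz⟩ := Submodule.mem_sup.mp ha
  refine ⟨y, conj z, ?_, ?_, ?_⟩
  · rw [piece_one_zero_eq_F_one hF0]; exact hy
  · rw [piece_one_zero_eq_F_one hF0]; exact mem_complexConj.mp hz
  · rw [conj_conj]; exact hyz.symm

/-- A `(1,0)`-class lies in `F¹H¹`. [folklore] -/
theorem mem_F_one_of_piece10 {X : U.Var} {a : U.CohC X 1} (ha : a ∈ (U.hodge X 1).piece 1 0) :
    a ∈ (U.hodge X 1).F 1 :=
  HodgeStructure.piece_le_F _ _ _ ha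

/-- Pull-back preserves `F¹H¹` (`Fact_pull_hodge`). [folklore] -/
theorem pullC_mem_F_one (hH : U.Fact_pull_hodge) {X Y : U.Var} (f : U.Mor X Y) {a : U.CohC Y 1}
    (ha : a ∈ (U.hodge Y 1).F 1) : U.pullC f 1 a ∈ (U.hodge X 1).F 1 :=
  hH _ _ f 1 1 (Submodule.mem_map_of_mem ha)

/-- Everything lies in `F⁰` (`Fact_hodge_F0`). [folklore] -/
theorem mem_F_zero (hF0 : U.Fact_hodge_F0) (X : U.Var) (k : ℕ) (x : U.CohC X k) : x ∈ (U.hodge X k).F 0 := by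
  rw [hF0]; exact Submodule.mem_top

/-- `F¹ ∪ F¹ ⊆ F²` in `H²`. [folklore] -/
theorem cup2C_mem_F_two (hcup2 : U.Fact_cup2_hodge) {X : U.Var} {u v : U.CohC X 1}
    (hu : u ∈ (U.hodge X 1).F 1) (hv : v ∈ (U.hodge X 1).F 1) : U.cup2C X 1 u v ∈ (U.hodge X 2).F 2 :=
  hcup2 X 1 1 1 u v hu hv

/-- `F¹ ∪ H¹ ⊆ F¹` in `H²`. [folklore] -/
theorem cup2C_mem_F_one_left (hcup2 : U.Fact_cup2_hodge) (hF0 : U.Fact_hodge_F0) {X : U.Var} {u : U.CohC X 1}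
    (hu : u ∈ (U.hodge X 1).F 1) (v : U.CohC X 1) : U.cup2C X 1 u v ∈ (U.hodge X 2).F 1 := by
  simpa using hcup2 X 1 1 0 u v hu (mem_F_zero hF0 X 1 v)

/-- `H¹ ∪ F¹ ⊆ F¹` in `H²`. [folklore] -/
theorem cup2C_mem_F_one_right (hcup2 : U.Fact_cup2_hodge) (hF0 : U.Fact_hodge_F0) {X : U.Var} (u : U.CohC X 1)
    {v : U.CohC X 1} (hv : v ∈ (U.hodge X 1).F 1) : U.cup2C X 1 u v ∈ (U.hodge X 2).F 1 := by
  simpa using hcup2 X 1 0 1 u v (mem_F_zero hF0 X 1 u) hv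

/-- `F¹ ∪ F¹` is a `(2,0)`-class. [folklore] -/
theorem cup2C_mem_piece20 (hcup2 : U.Fact_cup2_hodge) (hF0 : U.Fact_hodge_F0) {X : U.Var} {u v : U.CohC X 1}
    (hu : u ∈ (U.hodge X 1).F 1) (hv : v ∈ (U.hodge X 1).F 1) :
    U.cup2C X 1 u v ∈ (U.hodge X 2).piece 2 0 := by
  rw [HodgeStructure.mem_piece_iff _ (by norm_num)]
  exact ⟨cup2C_mem_F_two hcup2 hu hv, mem_F_zero hF0 X 2 _⟩

/-- `F¹ ∪ conj F¹` is a `(1,1)`-class. [folklore] -/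
theorem cup2C_mem_piece11_left (hcup2 : U.Fact_cup2_hodge) (hF0 : U.Fact_hodge_F0) {X : U.Var} {u v : U.CohC X 1}
    (hu : u ∈ (U.hodge X 1).F 1) (hv : conj v ∈ (U.hodge X 1).F 1) :
    U.cup2C X 1 u v ∈ (U.hodge X 2).piece 1 1 := by
  rw [HodgeStructure.mem_piece_iff _ (by norm_num)]
  refine ⟨cup2C_mem_F_one_left hcup2 hF0 hu v, ?_⟩
  rw [conj_cup2C X 1]
  exact cup2C_mem_F_one_right hcup2 hF0 _ hv

/-- `conj F¹ ∪ F¹` is a `(1,1)`-class. [folklore] -/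
theorem cup2C_mem_piece11_right (hcup2 : U.Fact_cup2_hodge) (hF0 : U.Fact_hodge_F0) {X : U.Var} {u v : U.CohC X 1}
    (hu : conj u ∈ (U.hodge X 1).F 1) (hv : v ∈ (U.hodge X 1).F 1) :
    U.cup2C X 1 u v ∈ (U.hodge X 2).piece 1 1 := by
  rw [HodgeStructure.mem_piece_iff _ (by norm_num)]
  refine ⟨cup2C_mem_F_one_right hcup2 hF0 u hv, ?_⟩
  rw [conj_cup2C X 1]
  exact cup2C_mem_F_one_left hcup2 hF0 hu _

/-- `conj F¹ ∪ conj F¹` is a `(0,2)`-class. [folklore] -/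
theorem cup2C_mem_piece02 (hcup2 : U.Fact_cup2_hodge) (hF0 : U.Fact_hodge_F0) {X : U.Var} {u v : U.CohC X 1}
    (hu : conj u ∈ (U.hodge X 1).F 1) (hv : conj v ∈ (U.hodge X 1).F 1) :
    U.cup2C X 1 u v ∈ (U.hodge X 2).piece 0 2 := by
  rw [HodgeStructure.mem_piece_iff _ (by norm_num)]
  refine ⟨mem_F_zero hF0 X 2 _, ?_⟩
  rw [conj_cup2C X 1]
  exact cup2C_mem_F_two hcup2 hu hv

/-- **Independence of the Hodge types of `H²`**: if `x + y + z = 0` with `x, y, z` of types `(2,0)`, `(1,1)`, `(0,2)`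
then `x = 0` and `y = 0` (the tree's `HodgeStructure.iSupIndep_piece_holds`). [folklore] -/
theorem eq_zero_of_pieces_two {X : U.Var} {x y z : U.CohC X 2} (hx : x ∈ (U.hodge X 2).piece 2 0)
    (hy : y ∈ (U.hodge X 2).piece 1 1) (hz : z ∈ (U.hodge X 2).piece 0 2) (h : x + y + z = 0) :
    x = 0 ∧ y = 0 := by
  set t : ℤ → Submodule ℂ (U.CohC X 2) := fun p => (U.hodge X 2).piece p (2 - p) with ht_def
  have ht : iSupIndep t := by
    have h0 := HodgeStructure.iSupIndep_piece_holds (U.hodge X 2)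
    simpa [t] using h0
  have hx' : x ∈ t 2 := by simpa [t] using hx
  have hy' : y ∈ t 1 := by simpa [t] using hy
  have hz' : z ∈ t 0 := by simpa [t] using hz
  constructor
  · have hd : Disjoint (t 2) (⨆ i ∈ ({1, 0} : Set ℤ), t i) := ht.disjoint_biSup (by norm_num)
    have hmem : x ∈ ⨆ i ∈ ({1, 0} : Set ℤ), t i := by
      have hxyz : x = -y + -z := by
        rw [← neg_add, eq_neg_iff_add_eq_zero, ← add_assoc]; exact h
      rw [hxyz]
      exact Submodule.add_mem _ (Submodule.neg_mem _ (le_biSup t (show (1 : ℤ) ∈ ({1, 0} : Set ℤ) by simp) hy'))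
        (Submodule.neg_mem _ (le_biSup t (show (0 : ℤ) ∈ ({1, 0} : Set ℤ) by simp) hz'))
    exact (Submodule.disjoint_def.mp hd) x hx' hmem
  · have hd : Disjoint (t 1) (⨆ i ∈ ({2, 0} : Set ℤ), t i) := ht.disjoint_biSup (by norm_num)
    have hmem : y ∈ ⨆ i ∈ ({2, 0} : Set ℤ), t i := by
      have hxyz : y = -x + -z := by
        rw [← neg_add, eq_neg_iff_add_eq_zero, ← add_assoc, add_comm y x]; exact h
      rw [hxyz]
      exact Submodule.add_mem _ (Submodule.neg_mem _ (le_biSup t (show (2 : ℤ) ∈ ({2, 0} : Set ℤ) by simp) hx'))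
        (Submodule.neg_mem _ (le_biSup t (show (0 : ℤ) ∈ ({2, 0} : Set ℤ) by simp) hz'))
    exact (Submodule.disjoint_def.mp hd) y hy' hmem

/-- **The alternation `(p ∪ q) ∪ (r ∪ s) = -((p ∪ s) ∪ (r ∪ q))`** of four degree-one classes (rows M19/M20: interchange
twice and one sign). [folklore] -/
theorem cup2C_cup2C_swap_inner (h1 : U.Fact_cup_comm1) (h2 : U.Fact_cup_interchange) (X : U.Var)
    (p q r s : U.CohC X 1) :
    U.cup2C X 2 (U.cup2C X 1 p q) (U.cup2C X 1 r s) = -(U.cup2C X 2 (U.cup2C X 1 p s) (U.cup2C X 1 r q)) := by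
  rw [cup2C_interchange h2 X p q r s, cup2C_comm1 h1 X q s, map_neg, cup2C_interchange h2 X p s r q, neg_neg]

/-! ### The wedge leaf for all degree-one classes from its holomorphic case -/

/-- **`HeckeWedge10 → HeckeWedge`** for every universe with `F⁰ = H`, `f^*`/`∪` filtered, the degree-one sign rules and
Hodge–Riemann `(2,0)` on its Picard modular surfaces: the Hecke-translate wedge for ALL non-zero degree-one classes follows
from the case of `(1,0)`-classes (Hodge decomposition `H¹ = H^{1,0} ⊕ conj H^{1,0}`, independence of the types of `H²`, and
`tr(η ∪ conj η) ≠ 0` read through `(p ∪ q) ∪ (r ∪ s) = -((p ∪ s) ∪ (r ∪ q))`). [folklore] -/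
theorem heckeWedge_of_heckeWedge10 (hH : U.Fact_pull_hodge) (hcup2 : U.Fact_cup2_hodge) (hF0 : U.Fact_hodge_F0)
    (h1 : U.Fact_cup_comm1) (h2 : U.Fact_cup_interchange)
    (hHR : ∀ {L : CMField} {ι₁ : L →+* ℂ} {V : HermSpace3 L ι₁} (Γ : Level V) (η : U.CohC (U.pms L ι₁ V Γ) 2),
      η ∈ (U.hodge (U.pms L ι₁ V Γ) 2).F 2 → η ≠ 0 → U.trC (U.pms L ι₁ V Γ) 4 (U.cup2C (U.pms L ι₁ V Γ) 2 η (conj η)) ≠ 0)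
    (hW : U.HeckeWedge10) : U.HeckeWedge := by
  intro L ι₁ V Γ a a' ha ha'
  obtain ⟨a₁, b, ha₁, hb, rfl⟩ := exists_piece10_add_conj hF0 _ a
  obtain ⟨a'₁, b', ha'₁, hb', rfl⟩ := exists_piece10_add_conj hF0 _ a'
  have ha₁F := mem_F_one_of_piece10 ha₁
  have hbF := mem_F_one_of_piece10 hb
  have ha'₁F := mem_F_one_of_piece10 ha'₁
  have hb'F := mem_F_one_of_piece10 hb'
  -- the four components of `g^*(a₁ + conj b) ∪ h^*(a'₁ + conj b')` and their Hodge types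
  have expand : ∀ {Γ' : Level V} (g h : U.Mor (U.pms L ι₁ V Γ') (U.pms L ι₁ V Γ)),
      U.cup2C _ 1 (U.pullC g 1 (a₁ + conj b)) (U.pullC h 1 (a'₁ + conj b')) =
        U.cup2C _ 1 (U.pullC g 1 a₁) (U.pullC h 1 a'₁) +
          (U.cup2C _ 1 (U.pullC g 1 a₁) (U.pullC h 1 (conj b')) + U.cup2C _ 1 (U.pullC g 1 (conj b)) (U.pullC h 1 a'₁)) +
          U.cup2C _ 1 (U.pullC g 1 (conj b)) (U.pullC h 1 (conj b')) := by
    intro Γ' g h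
    simp only [map_add, LinearMap.add_apply]
    abel
  have typ20 : ∀ {Γ' : Level V} (g h : U.Mor (U.pms L ι₁ V Γ') (U.pms L ι₁ V Γ)),
      U.cup2C _ 1 (U.pullC g 1 a₁) (U.pullC h 1 a'₁) ∈ (U.hodge (U.pms L ι₁ V Γ') 2).piece 2 0 := fun g h =>
    cup2C_mem_piece20 hcup2 hF0 (pullC_mem_F_one hH g ha₁F) (pullC_mem_F_one hH h ha'₁F)
  have typ11 : ∀ {Γ' : Level V} (g h : U.Mor (U.pms L ι₁ V Γ') (U.pms L ι₁ V Γ)),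
      U.cup2C _ 1 (U.pullC g 1 a₁) (U.pullC h 1 (conj b')) + U.cup2C _ 1 (U.pullC g 1 (conj b)) (U.pullC h 1 a'₁) ∈
        (U.hodge (U.pms L ι₁ V Γ') 2).piece 1 1 := fun g h =>
    Submodule.add_mem _
      (cup2C_mem_piece11_left hcup2 hF0 (pullC_mem_F_one hH g ha₁F)
        (by rw [conj_pullC, conj_conj]; exact pullC_mem_F_one hH h hb'F))
      (cup2C_mem_piece11_right hcup2 hF0 (by rw [conj_pullC, conj_conj]; exact pullC_mem_F_one hH g hbF)
        (pullC_mem_F_one hH h ha'₁F))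
  have typ02 : ∀ {Γ' : Level V} (g h : U.Mor (U.pms L ι₁ V Γ') (U.pms L ι₁ V Γ)),
      U.cup2C _ 1 (U.pullC g 1 (conj b)) (U.pullC h 1 (conj b')) ∈ (U.hodge (U.pms L ι₁ V Γ') 2).piece 0 2 :=
    fun g h => cup2C_mem_piece02 hcup2 hF0 (by rw [conj_pullC, conj_conj]; exact pullC_mem_F_one hH g hbF)
      (by rw [conj_pullC, conj_conj]; exact pullC_mem_F_one hH h hb'F)
  by_cases h₁0 : a₁ = 0
  · -- `a = conj b` with `b ≠ 0`
    subst h₁0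
    have hb0 : b ≠ 0 := by rintro rfl; exact ha (by simp)
    by_cases h₁0' : a'₁ = 0
    · -- (ii) `a' = conj b'`: conjugate the holomorphic wedge of `(b, b')`
      subst h₁0'
      have hb'0 : b' ≠ 0 := by rintro rfl; exact ha' (by simp)
      obtain ⟨Γ', g, h, hne⟩ := hW L ι₁ V Γ b b' hb hb' hb0 hb'0
      refine ⟨Γ', g, h, ?_⟩
      rw [zero_add, zero_add, ← conj_pullC, ← conj_pullC, ← conj_cup2C]
      intro h0
      exact hne (by simpa using congrArg conj h0)
    · -- (iv) `a'₁ ≠ 0`: holomorphic wedge of `(b, a'₁)`, Hodge–Riemann, and the `(1,1)`-component `g^*a ∪ h^*a'₁`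
      obtain ⟨Γ', g, h, hne⟩ := hW L ι₁ V Γ b a'₁ hb ha'₁ hb0 h₁0'
      refine ⟨Γ', g, h, ?_⟩
      intro h0
      rw [expand g h] at h0
      have h11 := (eq_zero_of_pieces_two (typ20 g h) (typ11 g h) (typ02 g h) h0).2
      simp only [map_zero, LinearMap.zero_apply, zero_add] at h11
      -- `η := g^*b ∪ h^*a'₁` is a non-zero `(2,0)`-class with `η ∪ conj η = -(… ∪ (g^*conj b ∪ h^*a'₁)) = 0`
      have hηF : U.cup2C _ 1 (U.pullC g 1 b) (U.pullC h 1 a'₁) ∈ (U.hodge (U.pms L ι₁ V Γ') 2).F 2 :=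
        cup2C_mem_F_two hcup2 (pullC_mem_F_one hH g hbF) (pullC_mem_F_one hH h ha'₁F)
      refine hHR Γ' _ hηF hne ?_
      rw [conj_cup2C _ 1, conj_pullC, conj_pullC, cup2C_cup2C_swap_inner h1 h2, h11, map_zero, neg_zero, map_zero]
  · by_cases h₁0' : a'₁ = 0
    · -- (iii) `a₁ ≠ 0`, `a' = conj b'`: holomorphic wedge of `(a₁, b')`, Hodge–Riemann, `(1,1)`-component `g^*a₁ ∪ h^*a'`
      subst h₁0'
      have hb'0 : b' ≠ 0 := by rintro rfl; exact ha' (by simp)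
      obtain ⟨Γ', g, h, hne⟩ := hW L ι₁ V Γ a₁ b' ha₁ hb' h₁0 hb'0
      refine ⟨Γ', g, h, ?_⟩
      intro h0
      rw [expand g h] at h0
      have h11 := (eq_zero_of_pieces_two (typ20 g h) (typ11 g h) (typ02 g h) h0).2
      simp only [map_zero, add_zero] at h11
      have hηF : U.cup2C _ 1 (U.pullC g 1 a₁) (U.pullC h 1 b') ∈ (U.hodge (U.pms L ι₁ V Γ') 2).F 2 :=
        cup2C_mem_F_two hcup2 (pullC_mem_F_one hH g ha₁F) (pullC_mem_F_one hH h hb'F)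
      refine hHR Γ' _ hηF hne ?_
      rw [conj_cup2C _ 1, conj_pullC, conj_pullC, cup2C_cup2C_swap_inner h1 h2, h11, map_zero, LinearMap.zero_apply,
        neg_zero, map_zero]
    · -- (i) both holomorphic parts non-zero: the `(2,0)`-component `g^*a₁ ∪ h^*a'₁`
      obtain ⟨Γ', g, h, hne⟩ := hW L ι₁ V Γ a₁ a'₁ ha₁ ha'₁ h₁0 h₁0'
      refine ⟨Γ', g, h, ?_⟩
      intro h0
      rw [expand g h] at h0
      exact hne (eq_zero_of_pieces_two (typ20 g h) (typ11 g h) (typ02 g h) h0).1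

end Universe

/-! ### The model universe: every input is a tree theorem -/

namespace Model

open Literature.NumberTheory.Automorphic
open Literature.NumberTheory.Automorphic.PicardCM
open Literature.AlgebraicGeometry.HodgeTheory

/-- **`HeckeWedge10 → HeckeWedge` on the model universe** `universeOf hHD hI hU h₃`, unconditionally: `F⁰ = H`
(`universeOf_fact_hodge_F0`), filtered `f^*`/`∪` (`universeOf_fact_pull_hodge/_cup2_hodge`), rows M19/M20
(`universeOf_cup_comm1/_cup_interchange`) and Hodge–Riemann `(2,0)` (`universeOf_hodgeRiemann_pms`) are tree theorems. [folklore] -/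
theorem universeOf_heckeWedge_of_heckeWedge10 (hHD : exists_isReal_hodgeModel) (hI : hodgePQ_independent_of_hodgeModel)
    (hU : BallQuotientUniformisedDatum) (h₃ : CMAbelianVarietyRealised)
    (hW : (universeOf hHD hI hU h₃).HeckeWedge10) : (universeOf hHD hI hU h₃).HeckeWedge :=
  Universe.heckeWedge_of_heckeWedge10 (universeOf_fact_pull_hodge hHD hI hU h₃) (universeOf_fact_cup2_hodge hHD hI hU h₃)
    (universeOf_fact_hodge_F0 hHD hI hU h₃) (universeOf_cup_comm1 hHD hI hU h₃) (universeOf_cup_interchange hHD hI hU h₃)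
    (fun Γ η hη h0 => universeOf_hodgeRiemann_pms hHD hI hU h₃ _ Γ η hη h0) hW

/-- The same on `picardCMUniverse hHD hI h₁ h₃` (`= universeOf hHD hI (ballQuotientUniformisedDatum_of h₁) h₃`), the universe over
which B01 quantifies: the full leaf `HeckeWedge` follows from the holomorphic leaf `HeckeWedge10` (B01-H). [folklore] -/
theorem picardCMUniverse_heckeWedge_of_heckeWedge10 (hHD : exists_isReal_hodgeModel)
    (hI : hodgePQ_independent_of_hodgeModel) (h₁ : BallQuotientUniformised) (h₃ : CMAbelianVarietyRealised)
    (hW : (picardCMUniverse hHD hI h₁ h₃).HeckeWedge10) : (picardCMUniverse hHD hI h₁ h₃).HeckeWedge :=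
  universeOf_heckeWedge_of_heckeWedge10 hHD hI (ballQuotientUniformisedDatum_of h₁) h₃ hW

end Model

end Summit.HodgeConjecture.CorCM

end
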